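import Literature.NumberTheory.Rogawski1990.ArchCentralLimitExistsLetter           -- ★ (A6′) def `ArchCentralLimitExists` (F0P3a-p09 (g2), statement lane)
import Literature.NumberTheory.Rogawski1990.ArchCentralLimitFormulaOfLimitExists    -- ★ p846447 FILE B: `archCentralLimitFormulaRankTwo_of_limitExists_of_core` (the letter from A6′ unfolded + `hcore`)
import HarnessLib

/-!
# THE (L_{U(2,1)}) LETTER FROM THE NAMED ROW (A6′) `ArchCentralLimitExists` AND W6-core — the def-typed bridge for the closer ∕ «SdArch» ED. 6
# (Rogawski 1990 §8.4 p. 126 L13; Harish-Chandra 1975 [H₂] L. 17.5)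

Topic `NumberTheory/Rogawski1990`; namespace `Literature.NumberTheory.Rogawski1990`.  THEOREMS ONLY (no `def`, no instance, no notation, no axiom, no named fact, no `sorry`).  Cell
`pub/hodgecm-mathlib`, ENGINE T1 (crux H413 = `stmt-HodgeConjecture-24833`), supports-only lane; «A6′» FILE D3 (F0P3a-p09 (g2), 2026-09-01; ROAD A owner F0P3a-p05 (g15) R-15.4, LEAD
F0P3a-plan (g12) T11-1).  ★ FILE B states its print hypothesis UNFOLDED (the def landed after it); this file restates the two junctions BY NAME over the ★ def `ArchCentralLimitExists`:
* `ArchCentralLimitExists.of_rankTwo` — the letter ★ `ArchCentralLimitFormulaRankTwo L α w` implies (A6′) (forget the value): (A6′) is a WEAKENING of the letter;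
* **`archCentralLimitFormulaRankTwo_of_archCentralLimitExists_of_core (hex : ∀ L α w, ArchCentralLimitExists L α w) (hcore : ‹stub_W6core›) : ∀ L α w, ArchCentralLimitFormulaRankTwo L α w`** —
  the closer-shaped bridge: `stub_ArchCentralLimitU21 := archCentralLimitFormulaRankTwo_of_archCentralLimitExists_of_core stub_A6' stub_W6core` («SdArch» ED. 6 ∕ closer ED. 35 (β),
  LEAD's call).
So over the tree (A6′) ⟺ the letter: the honest content of the re-denomination «A6 ↦ A6′» of print row #179 is that Harish-Chandra's boundary-REGULARITY theorem (C³ corner extensions on six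
chambers, ★ `ArchCentralLimitCornerRegularity`) leaves N1's trust base and only the EXISTENCE of the central limit of `ω[ρ′Δ·Φ_G]` — Rogawski's literal half-sentence — stays cited.
HONEST LABEL: HC_CM is proved only modulo the printed citations until rung 0 closes; bookkeeping, pays no row by itself.

## References
* [Rogawski1990] J. D. Rogawski, *Automorphic Representations of Unitary Groups in Three Variables*, Ann. of Math. Stud. 123 (1990), §8.4 pp. 126–127.
* [HarishChandra1975HARRG1] Harish-Chandra, *Harmonic analysis on real reductive groups. I*, J. Funct. Anal. 19 (1975) 104–204, §17 Lemma 17.5 (cited through Rogawski).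
-/

set_option autoImplicit false

noncomputable section

open Filter Topology Set MeasureTheory Measure NumberField NumberField.InfinitePlace
open scoped Matrix MatrixGroups Matrix.Norms.Operator
open Literature.NumberTheory.Automorphic Literature.NumberTheory.Automorphic.UnitaryGroup
open Literature.Geometry.ComplexHyperbolic Literature.Geometry.ComplexHyperbolic.BallModel

namespace Literature.NumberTheory.Rogawski1990

/-- **The letter implies (A6′)**: forget the value. [cite: Rogawski1990, §8.4 p. 126 L13] -/
theorem ArchCentralLimitExists.of_rankTwo {L : Type} [Field L] {α : Fin 3 → L} {w : {w : InfinitePlace L // IsComplex w}}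
    (h : ArchCentralLimitFormulaRankTwo L α w) : ArchCentralLimitExists L α w := by
  intro _ _ _ _ hα hreal hind ν _ _ Θ hΘ hΘc ζ
  obtain ⟨c, -, hc⟩ := h hα hreal hind ν
  exact ⟨_, hc Θ hΘ hΘc ζ⟩

/-- **THE (L_{U(2,1)}) LETTER AT EVERY FRAME FROM THE NAMED ROW (A6′) ★ `ArchCentralLimitExists` AND W6-core's `hcore`** (= ★ `stub_W6core` text VERBATIM) — the closer-shaped bridge BY NAME
over ★ FILE B `archCentralLimitFormulaRankTwo_of_limitExists_of_core` (the def unfolds onto FILE B's inline hypothesis). [cite: Rogawski1990, §8.4 pp. 126–127] [cite: HarishChandra1975HARRG1, §17 Lemma 17.5] -/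
theorem archCentralLimitFormulaRankTwo_of_archCentralLimitExists_of_core
    (hex : ∀ (L : Type) [Field L] (α : Fin 3 → L) (w : {w : InfinitePlace L // IsComplex w}), ArchCentralLimitExists L α w)
    (hcore : ∀ (μ : Measure BallModel.U21) [μ.IsHaarMeasure],
      ∃ c : ℝ, 0 < c ∧ ∀ (Θ : Matrix (Fin 3) (Fin 3) ℂ → ℂ), ContDiff ℝ (⊤ : ℕ∞) Θ → HasCompactSupport Θ →
        (∀ κ : Matrix (Fin 3) (Fin 3) ℂ, κ * κᴴ = 1 → κ * BallModel.J = BallModel.J * κ → ∀ X, Θ (κ * X * κᴴ) = Θ X) →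
        ∀ ζ : Circle, ∃ (δ : ℝ) (ψ χ : ℝ → ℂ), 0 < δ ∧ δ ≤ 2 ∧ ContDiffOn ℝ 2 ψ (Icc 0 δ) ∧ ContDiffOn ℝ 2 χ (Icc 0 δ) ∧
          (∀ t ∈ Ioo 0 δ, (2 - 2 * Real.cos (3 * t)) • (∫ g, Θ (BallModel.mat (g * BallModel.mkU21 (Matrix.diagonal ![((ζ * Circle.exp t : Circle) : ℂ), ((ζ * Circle.exp t : Circle) : ℂ), ((ζ * Circle.exp (-2 * t) : Circle) : ℂ)]) (BallModel.diagonal_uuv_preserves (ζ * Circle.exp t) (ζ * Circle.exp (-2 * t))) * g⁻¹)) ∂μ) = ψ t) ∧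
          (∀ t ∈ Ioo 0 δ, ‖((ζ * Circle.exp (-2 * t) : Circle) : ℂ) - ((ζ * Circle.exp t : Circle) : ℂ)‖ ^ 4 •
            iteratedDeriv 2 (fun y : ℝ => ∫ u : BallModel.U21, Θ (BallModel.mat u * Matrix.diagonal (fun k : Fin 3 => (((![ζ * Circle.exp t, ζ * Circle.exp t, ζ * Circle.exp (-2 * t)] : Fin 3 → Circle) k * Circle.exp (y * ((if k = (0 : Fin 3) then (1 : ℝ) else 0) - (if k = (1 : Fin 3) then (1 : ℝ) else 0))) : Circle) : ℂ)) * BallModel.mat u⁻¹) ∂μ) 0 = χ t) ∧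
          -(2 / 3) * Complex.I * iteratedDerivWithin 2 ψ (Icc 0 δ) 0 - (1 / 2) * Complex.I * ψ 0 + (1 / 12) * Complex.I * iteratedDerivWithin 2 χ (Icc 0 δ) 0 =
            -((c : ℂ) * Complex.I) * Θ ((ζ : ℂ) • (1 : Matrix (Fin 3) (Fin 3) ℂ))) :
    ∀ (L : Type) [Field L] (α : Fin 3 → L) (w : {w : InfinitePlace L // IsComplex w}), ArchCentralLimitFormulaRankTwo L α w :=
  archCentralLimitFormulaRankTwo_of_limitExists_of_core hex hcore

end Literature.NumberTheory.Rogawski1990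

end
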